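import Mathlib.Data.Finset.Sups
import Mathlib.Data.Finset.Card
import Mathlib.Data.Finset.Lattice.Fold
import HarnessLib

/-!
# A hypothesis-free two-family Marica–Schönheim inequality (`T′`) and its pinned corollary

Support file for crux `stmt-CriticalPhenomena-4575` (master-family programme, quadratic four-point row `Q44b`
of `prim-bnk-1` gen 13, OPEN for all `n`), seat `prim-l12-p6` gen 9; memo
`run/shared/lean/prim/prim-l12/FROM-prim-l12-p6-g9-ORIENTED-ANTIPODAL.md` §4 (Theorem G / Corollary T′).

For families `𝒳, 𝒴` of finite sets write `𝒳 \\ 𝒴 = {X \ Y : X ∈ 𝒳, Y ∈ 𝒴}` (`Finset.diffs`).  The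
Marica–Schönheim inequality is `#𝒳 ≤ #(𝒳 \\ 𝒳)` (Mathlib: `Finset.card_le_card_diffs`).  Here we prove the
two-family strengthening

* `Q44bMS.card_add_card_le_card_diffs_union_add` (**T′**):
  `#𝒜 + #ℬ ≤ #(𝒜 \\ 𝒜 ∪ ℬ \\ ℬ) + #(ℬ \\ 𝒜)` for ALL families `𝒜, ℬ` (no hypothesis),

by the element induction of Ahlswede–Daykin 1979 (Thm 37 in Ahlswede–Blinovsky, *Lectures on Advances in
Combinatorics*): split a family `𝒳` at an element `a` into the projection `𝒳.image (·.erase a)` and the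
doubled part `{X : a ∉ X, X ∈ 𝒳, insert a X ∈ 𝒳}` (`card_dbl_add_card_proj`), and lift differences of the two
parts back into pairs `{E, insert a E}` (`card_add_card_le_of_lift`).  Consequence:

* `Q44bMS.card_add_card_le_card_diffs_union₃_of_pinned` (**pinned FB-MS**): if some element lies in every
  member of `ℬ` and in no member of `𝒜`, then `#𝒜 + #ℬ ≤ #(𝒜 \\ 𝒜 ∪ ℬ \\ ℬ ∪ ℬ \\ 𝒜)` — the pinned case of
  the conjecture FB-MS of `prim-bnk-1` gen 15 (memo §4), which is the two-family core of the oriented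
  Marica–Schönheim route to `Q44b`.

Pure finite combinatorics; no named facts, no sorries, standard axioms.
-/

namespace Summit.CriticalPhenomena.PercolationContinuityZ3.Theorems

namespace Q44bMS

open Finset
open scoped FinsetFamily

variable {β : Type*} [DecidableEq β]

/-- **Lifting count.**  If every member of `U₁` is `a`-free and lies in `U` together with its `a`-extension,
and every member of `U₂` is `a`-free and lies in `U` or has its `a`-extension in `U`, then `#U₁ + #U₂ ≤ #U`
(the pairs `{E, insert a E}` are counted twice resp. once). [this work] -/
theorem card_add_card_le_of_lift (a : β) (U U₁ U₂ : Finset (Finset β))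
    (h₁ : ∀ E ∈ U₁, a ∉ E ∧ E ∈ U ∧ insert a E ∈ U)
    (h₂ : ∀ E ∈ U₂, a ∉ E ∧ (E ∈ U ∨ insert a E ∈ U)) :
    #U₁ + #U₂ ≤ #U := by
  set U0 := U.filter (fun E => a ∉ E) with hU0
  set Up := U.filter (fun E => a ∈ E) with hUp
  set Ue := Up.image (fun E => E.erase a) with hUe
  have hcardU : #Up + #U0 = #U := by
    rw [hUp, hU0]
    exact card_filter_add_card_filter_not (fun E => a ∈ E)
  have hUe_card : #Ue = #Up := by
    rw [hUe]
    refine card_image_of_injOn ?_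
    intro x hx y hy hxy
    have hx' : x ∈ U ∧ a ∈ x := by simpa [hUp] using hx
    have hy' : y ∈ U ∧ a ∈ y := by simpa [hUp] using hy
    exact (erase_injOn' a) hx'.2 hy'.2 hxy
  have hsub1 : U₁ ⊆ U0 ∩ Ue := by
    intro E hE
    obtain ⟨haE, hEU, hinsU⟩ := h₁ E hE
    refine mem_inter.2 ⟨?_, ?_⟩
    · exact mem_filter.2 ⟨hEU, haE⟩
    · refine mem_image.2 ⟨insert a E, mem_filter.2 ⟨hinsU, mem_insert_self a E⟩, ?_⟩
      exact erase_insert haE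
  have hsub2 : U₂ ⊆ U0 ∪ Ue := by
    intro E hE
    obtain ⟨haE, hor⟩ := h₂ E hE
    rcases hor with hEU | hinsU
    · exact mem_union_left _ (mem_filter.2 ⟨hEU, haE⟩)
    · refine mem_union_right _ (mem_image.2 ⟨insert a E, mem_filter.2 ⟨hinsU, mem_insert_self a E⟩, ?_⟩)
      exact erase_insert haE
  have h1 : #U₁ ≤ #(U0 ∩ Ue) := card_le_card hsub1
  have h2 : #U₂ ≤ #(U0 ∪ Ue) := card_le_card hsub2
  have hie : #(U0 ∪ Ue) + #(U0 ∩ Ue) = #U0 + #Ue := card_union_add_card_inter U0 Ue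
  omega

/-- **Splitting count**: (number of doubled `a`-free members) + (number of distinct erasures) = `#𝒳`. [this work] -/
theorem card_dbl_add_card_proj (a : β) (𝒳 : Finset (Finset β)) :
    #(((𝒳).filter (fun X => a ∉ X ∧ insert a X ∈ 𝒳))) + #(((𝒳).image (fun X => X.erase a))) = #𝒳 := by
  set X0 := 𝒳.filter (fun E => a ∉ E) with hX0
  set Xp := 𝒳.filter (fun E => a ∈ E) with hXp
  set Xe := Xp.image (fun E => E.erase a) with hXe
  have hcard : #Xp + #X0 = #𝒳 := by
    rw [hXp, hX0]
    exact card_filter_add_card_filter_not (fun E => a ∈ E)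
  have hXe_card : #Xe = #Xp := by
    rw [hXe]
    refine card_image_of_injOn ?_
    intro x hx y hy hxy
    have hx' : x ∈ 𝒳 ∧ a ∈ x := by simpa [hXp] using hx
    have hy' : y ∈ 𝒳 ∧ a ∈ y := by simpa [hXp] using hy
    exact (erase_injOn' a) hx'.2 hy'.2 hxy
  have hproj : ((𝒳).image (fun X => X.erase a)) = X0 ∪ Xe := by
    ext E
    rw [mem_image, mem_union]
    constructor
    · rintro ⟨X, hX, rfl⟩
      by_cases haX : a ∈ X
      · right
        exact mem_image.2 ⟨X, mem_filter.2 ⟨hX, haX⟩, rfl⟩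
      · left
        rw [erase_eq_of_notMem haX]
        exact mem_filter.2 ⟨hX, haX⟩
    · rintro (hE | hE)
      · obtain ⟨hEX, haE⟩ := mem_filter.1 hE
        exact ⟨E, hEX, erase_eq_of_notMem haE⟩
      · obtain ⟨X, hX, hXE⟩ := mem_image.1 hE
        exact ⟨X, (mem_filter.1 hX).1, hXE⟩
  have hdbl : ((𝒳).filter (fun X => a ∉ X ∧ insert a X ∈ 𝒳)) = X0 ∩ Xe := by
    ext E
    rw [mem_filter, mem_inter]
    constructor
    · rintro ⟨hE, haE, hins⟩
      refine ⟨mem_filter.2 ⟨hE, haE⟩, ?_⟩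
      exact mem_image.2 ⟨insert a E, mem_filter.2 ⟨hins, mem_insert_self a E⟩, erase_insert haE⟩
    · rintro ⟨hE0, hEe⟩
      obtain ⟨hE, haE⟩ := mem_filter.1 hE0
      obtain ⟨X, hX, hXE⟩ := mem_image.1 hEe
      obtain ⟨hXX, haX⟩ := mem_filter.1 hX
      refine ⟨hE, haE, ?_⟩
      have : insert a E = X := by
        rw [← hXE]
        exact insert_erase haX
      rw [this]
      exact hXX
  rw [hproj, hdbl]
  have hie : #(X0 ∪ Xe) + #(X0 ∩ Xe) = #X0 + #Xe := card_union_add_card_inter X0 Xe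
  omega

/-- Differences of doubled parts lift in pairs: a difference `E` of doubled `a`-free members of `𝒳` and `𝒴` is
`a`-free and both `E` and `insert a E` lie in `𝒳 \\ 𝒴`. [this work] -/
theorem lift_dbl {a : β} {𝒳 𝒴 : Finset (Finset β)} {E : Finset β} (hE : E ∈ ((𝒳).filter (fun X => a ∉ X ∧ insert a X ∈ 𝒳)) \\ ((𝒴).filter (fun X => a ∉ X ∧ insert a X ∈ 𝒴))) :
    a ∉ E ∧ E ∈ 𝒳 \\ 𝒴 ∧ insert a E ∈ 𝒳 \\ 𝒴 := by
  obtain ⟨S, hS, T, hT, rfl⟩ := mem_diffs.1 hE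
  obtain ⟨hSX, haS, hinsS⟩ := mem_filter.1 hS
  obtain ⟨hTY, haT, _⟩ := mem_filter.1 hT
  refine ⟨?_, sdiff_mem_diffs hSX hTY, ?_⟩
  · exact fun h => haS (mem_sdiff.1 h).1
  · rw [← insert_sdiff_of_notMem S haT]
    exact sdiff_mem_diffs hinsS hTY

/-- Differences of projections lift to at least one member of a pair: a difference `E` of erasures of members
of `𝒳` and `𝒴` is `a`-free and `E` or `insert a E` lies in `𝒳 \\ 𝒴`. [this work] -/
theorem lift_proj {a : β} {𝒳 𝒴 : Finset (Finset β)} {E : Finset β} (hE : E ∈ ((𝒳).image (fun X => X.erase a)) \\ ((𝒴).image (fun X => X.erase a))) :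
    a ∉ E ∧ (E ∈ 𝒳 \\ 𝒴 ∨ insert a E ∈ 𝒳 \\ 𝒴) := by
  obtain ⟨S', hS', T', hT', rfl⟩ := mem_diffs.1 hE
  obtain ⟨S, hS, rfl⟩ := mem_image.1 hS'
  obtain ⟨T, hT, rfl⟩ := mem_image.1 hT'
  have hkey : (S \ T).erase a = S.erase a \ T.erase a := erase_sdiff_distrib S T a
  refine ⟨fun h => (notMem_erase a S) (mem_sdiff.1 h).1, ?_⟩
  by_cases ha : a ∈ S \ T
  · right
    rw [← hkey, insert_erase ha]
    exact sdiff_mem_diffs hS hT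
  · left
    rw [← hkey, erase_eq_of_notMem ha]
    exact sdiff_mem_diffs hS hT

/-- `T′` for families supported in a fixed finite set `u` (the induction). [this work] -/
theorem card_add_card_le_aux (u : Finset β) :
    ∀ 𝒜 ℬ : Finset (Finset β), (∀ A ∈ 𝒜, A ⊆ u) → (∀ B ∈ ℬ, B ⊆ u) →
      #𝒜 + #ℬ ≤ #(𝒜 \\ 𝒜 ∪ ℬ \\ ℬ) + #(ℬ \\ 𝒜) := by
  induction u using Finset.induction_on with
  | empty =>
    intro 𝒜 ℬ h𝒜 hℬ
    have h𝒜' : 𝒜 ⊆ {∅} := fun A hA => mem_singleton.2 (subset_empty.1 (h𝒜 A hA))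
    have hℬ' : ℬ ⊆ {∅} := fun B hB => mem_singleton.2 (subset_empty.1 (hℬ B hB))
    rcases subset_singleton_iff.1 h𝒜' with rfl | rfl <;>
      rcases subset_singleton_iff.1 hℬ' with rfl | rfl <;>
      simp
  | insert a u ha ih =>
    intro 𝒜 ℬ h𝒜 hℬ
    -- supports of the two parts
    have hd : ∀ 𝒳 : Finset (Finset β), (∀ X ∈ 𝒳, X ⊆ insert a u) → ∀ X ∈ ((𝒳).filter (fun X => a ∉ X ∧ insert a X ∈ 𝒳)), X ⊆ u := by
      intro 𝒳 h𝒳 X hX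
      obtain ⟨hXX, haX, _⟩ := mem_filter.1 hX
      intro x hx
      have := h𝒳 X hXX hx
      rcases mem_insert.1 this with rfl | hxu
      · exact absurd hx haX
      · exact hxu
    have hp : ∀ 𝒳 : Finset (Finset β), (∀ X ∈ 𝒳, X ⊆ insert a u) → ∀ X ∈ ((𝒳).image (fun X => X.erase a)), X ⊆ u := by
      intro 𝒳 h𝒳 E hE
      obtain ⟨X, hX, rfl⟩ := mem_image.1 hE
      intro x hx
      have hxX : x ∈ X := (mem_erase.1 hx).2
      have hxa : x ≠ a := (mem_erase.1 hx).1
      rcases mem_insert.1 (h𝒳 X hX hxX) with h | hxu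
      · exact absurd h hxa
      · exact hxu
    have ih1 := ih (((𝒜).filter (fun X => a ∉ X ∧ insert a X ∈ 𝒜))) (((ℬ).filter (fun X => a ∉ X ∧ insert a X ∈ ℬ))) (hd 𝒜 h𝒜) (hd ℬ hℬ)
    have ih2 := ih (((𝒜).image (fun X => X.erase a))) (((ℬ).image (fun X => X.erase a))) (hp 𝒜 h𝒜) (hp ℬ hℬ)
    -- lifting for the union U = 𝒜 \\ 𝒜 ∪ ℬ \\ ℬ
    have hU : #(((𝒜).filter (fun X => a ∉ X ∧ insert a X ∈ 𝒜)) \\ ((𝒜).filter (fun X => a ∉ X ∧ insert a X ∈ 𝒜)) ∪ ((ℬ).filter (fun X => a ∉ X ∧ insert a X ∈ ℬ)) \\ ((ℬ).filter (fun X => a ∉ X ∧ insert a X ∈ ℬ))) + #(((𝒜).image (fun X => X.erase a)) \\ ((𝒜).image (fun X => X.erase a)) ∪ ((ℬ).image (fun X => X.erase a)) \\ ((ℬ).image (fun X => X.erase a)))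
        ≤ #(𝒜 \\ 𝒜 ∪ ℬ \\ ℬ) := by
      refine card_add_card_le_of_lift a _ _ _ ?_ ?_
      · intro E hE
        rcases mem_union.1 hE with hE | hE
        · obtain ⟨h1, h2, h3⟩ := lift_dbl hE
          exact ⟨h1, mem_union_left _ h2, mem_union_left _ h3⟩
        · obtain ⟨h1, h2, h3⟩ := lift_dbl hE
          exact ⟨h1, mem_union_right _ h2, mem_union_right _ h3⟩
      · intro E hE
        rcases mem_union.1 hE with hE | hE
        · obtain ⟨h1, h2⟩ := lift_proj hE
          exact ⟨h1, h2.imp (mem_union_left _) (mem_union_left _)⟩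
        · obtain ⟨h1, h2⟩ := lift_proj hE
          exact ⟨h1, h2.imp (mem_union_right _) (mem_union_right _)⟩
    -- lifting for V = ℬ \\ 𝒜
    have hV : #(((ℬ).filter (fun X => a ∉ X ∧ insert a X ∈ ℬ)) \\ ((𝒜).filter (fun X => a ∉ X ∧ insert a X ∈ 𝒜))) + #(((ℬ).image (fun X => X.erase a)) \\ ((𝒜).image (fun X => X.erase a))) ≤ #(ℬ \\ 𝒜) := by
      refine card_add_card_le_of_lift a _ _ _ ?_ ?_
      · intro E hE
        exact lift_dbl hE
      · intro E hE
        exact lift_proj hE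
    have hcA := card_dbl_add_card_proj a 𝒜
    have hcB := card_dbl_add_card_proj a ℬ
    omega

/-- **T′ (hypothesis-free two-family Marica–Schönheim).**  For all finite families `𝒜, ℬ` of finite sets,
`#𝒜 + #ℬ ≤ #(𝒜 \\ 𝒜 ∪ ℬ \\ ℬ) + #(ℬ \\ 𝒜)`. [this work] -/
theorem card_add_card_le_card_diffs_union_add (𝒜 ℬ : Finset (Finset β)) :
    #𝒜 + #ℬ ≤ #(𝒜 \\ 𝒜 ∪ ℬ \\ ℬ) + #(ℬ \\ 𝒜) := by
  refine card_add_card_le_aux ((𝒜 ∪ ℬ).sup id) 𝒜 ℬ ?_ ?_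
  · intro A hA
    exact le_sup (f := id) (mem_union_left _ hA)
  · intro B hB
    exact le_sup (f := id) (mem_union_right _ hB)

/-- **Pinned FB-MS.**  If an element `a` lies in every member of `ℬ` and in no member of `𝒜`, then
`#𝒜 + #ℬ ≤ #(𝒜 \\ 𝒜 ∪ ℬ \\ ℬ ∪ ℬ \\ 𝒜)`: the members of `ℬ \\ 𝒜` contain `a`, those of `𝒜 \\ 𝒜 ∪ ℬ \\ ℬ`
do not, so the union is disjoint and `T′` applies. [this work] -/
theorem card_add_card_le_card_diffs_union₃_of_pinned (a : β) (𝒜 ℬ : Finset (Finset β))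
    (h𝒜 : ∀ A ∈ 𝒜, a ∉ A) (hℬ : ∀ B ∈ ℬ, a ∈ B) :
    #𝒜 + #ℬ ≤ #(𝒜 \\ 𝒜 ∪ ℬ \\ ℬ ∪ ℬ \\ 𝒜) := by
  have hdis : Disjoint (𝒜 \\ 𝒜 ∪ ℬ \\ ℬ) (ℬ \\ 𝒜) := by
    rw [disjoint_left]
    intro E hE hE'
    obtain ⟨B, hB, A, hA, rfl⟩ := mem_diffs.1 hE'
    have haE : a ∈ B \ A := mem_sdiff.2 ⟨hℬ B hB, h𝒜 A hA⟩
    rcases mem_union.1 hE with hE | hE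
    · obtain ⟨A1, hA1, A2, _, hEq⟩ := mem_diffs.1 hE
      have : a ∈ A1 := (mem_sdiff.1 (hEq ▸ haE)).1
      exact h𝒜 A1 hA1 this
    · obtain ⟨B1, _, B2, hB2, hEq⟩ := mem_diffs.1 hE
      have : a ∉ B2 := (mem_sdiff.1 (hEq ▸ haE)).2
      exact this (hℬ B2 hB2)
  rw [card_union_of_disjoint hdis]
  exact card_add_card_le_card_diffs_union_add 𝒜 ℬ

end Q44bMS

end Summit.CriticalPhenomena.PercolationContinuityZ3.Theorems
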